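import Summits.QuantumFields.YangMills.Theorems.ChatterjeeMassGapTorusAxialOneBitFiniteVolume
import Summits.QuantumFields.YangMills.Theorems.ChatterjeeMassGapTorusAxialOneBitBoxUnique
import Literature.MathematicalPhysics.QuantumFieldTheory.StrongCouplingLeadingCoefficient
import HarnessLib

/-!
# The one bit of `S28ᵀ` is certified for `SU(2)`: the island gap core holds (item 8941 lane)

Seat ym-dw-p1 g6. The LINE-8/9/9b chain of ym-idea-4 (`…HalfSpaceTransfer`, `…OneBit`,
`…WitnessJets`, `…OneBitFiniteVolume`) reduced the gap core of the torus–axial re-typing `S28ᵀ` of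
Chatterjee's Problem 5.1 on the strong-coupling island — for every sufficiently small `β > 0`,
EVERY torus-limit state has strictly positive axial plaquette correlations at all distances and a
positive inverse correlation length — to ONE number: some Taylor coefficient at `β = 0` of the
free-boundary truncated correlation `p_Λ` of the perpendicular pair `Q_0^{(12)}, P_{e₀}^{(01)}`,
non-zero for all large `Λ` (`S28OneBitFiniteVolume.gapCore_eventually_of_freeCoefficient_of_forall`).
This file DISCHARGES that hypothesis for `G = SU(2)` in the fundamental representation, `d = 4`:

* `kappa_SU2` — the leading coefficient is the box integral: `κ = 2⁻⁸` (`boxIntegral_plaquetteObs`,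
  `integral_trace_re_eq_zero`);
* `truncated_SU2_isBigO` — for every finite region `Λ` containing the twelve vertices of the box,
  `⟨QP⟩_Λ(t) - ⟨Q⟩_Λ(t)⟨P⟩_Λ(t) = 2⁻⁸ t⁸ + O(t⁹)` (the generic leading-coefficient theorem
  `Literature…StrongCouplingLeading.truncated_sub_leading_isBigO` with (H1) `box_H1` and (H2)
  `box_sphere`);
* `iteratedDeriv_eight_SU2` — hence `p_Λ^{(8)}(0) = 8!/256 ≠ 0` for all such `Λ` (jet comparison of
  real-analytic germs, `S28WitnessJets.iteratedDeriv_eq_of_isBigO_sub`);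
* `gapCore_eventually_SU2` — **the island gap core for `SU(2)`**: `∀ᶠ β ∈ 𝓝[>] 0`, every
  torus-limit state `μ ∈ infiniteVolumeLimitPoints (fundamentalRep (Fin 2)) β` has
  `f_{β,μ}(n e₀) > 0` for all `n` and `∃ m > 0, HasInvCorrLength f_{β,μ} m`.

HONEST FRAMING. This is the non-degeneracy of Osterwalder–Seiler strong-coupling clustering for
small `β > 0`, made uniform over torus-limit states and with the positivity of the axial rate; it
says NOTHING for `β ≥ β₀`, nothing about a continuum limit, and proves no summit conjunct: the
Yang–Mills mass gap is NOT proved. References: K. Osterwalder, E. Seiler, Ann. Phys. 110 (1978)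
440; G. Münster, Nucl. Phys. B 180 (1981) 23; S. Chatterjee, arXiv:1803.01950, Problem 5.1.
-/

noncomputable section

open MeasureTheory Filter Topology Asymptotics Finset
open Literature.MathematicalPhysics.QuantumLattice
open Literature.MathematicalPhysics.QuantumFieldTheory
open Literature.Probability.LatticeModels (Site HasInvCorrLength)

namespace Summit.QuantumFields.YangMills.Theorems.S28OneBitSU2

open S28OneBitBox

/-- `Q₀`, the eight faces of the box other than `q₁, q₂`, is a subset of `Λ'` as soon as `Λ`
contains the twelve vertices of the box. -/
theorem box_subset_plaqSet (Λ : Finset (Site 4))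
    (hΛ : ({![0,0,0,0], ![0,0,1,0], ![0,1,0,0], ![0,1,1,0], ![1,0,0,0], ![1,0,1,0], ![1,1,0,0], ![1,1,1,0],
        ![2,0,0,0], ![2,0,1,0], ![2,1,0,0], ![2,1,1,0]} : Finset (Site 4)) ⊆ Λ) :
    ({(![2,0,0,0], ⟨(1, 2), lt12⟩), (![0,0,0,0], ⟨(0, 1), lt01⟩), (![0,0,1,0], ⟨(0, 1), lt01⟩), (![0,0,0,0], ⟨(0, 2),
        lt02⟩), (![0,1,0,0], ⟨(0, 2), lt02⟩), (![1,0,1,0], ⟨(0, 1), lt01⟩), (![1,0,0,0], ⟨(0, 2), lt02⟩),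
        (![1,1,0,0], ⟨(0, 2), lt02⟩)} : Finset (ZdPlaquette 4)) ⊆ plaqSet Λ := by
  classical
  intro p hp
  -- membership in `plaqSet Λ` from membership of the label in `plaquettesIn Λ`
  have key : ∀ (x : Site 4) (i j : Fin 4) (h : ((i, j) : Fin 4 × Fin 4).1 < ((i, j) : Fin 4 × Fin 4).2),
      x ∈ Λ → x + Pi.single i 1 ∈ Λ → x + Pi.single j 1 ∈ Λ → x + Pi.single i 1 + Pi.single j 1 ∈ Λ →
      ((x, ⟨(i, j), h⟩) : ZdPlaquette 4) ∈ plaqSet Λ := by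
    intro x i j h hx hxi hxj hxij
    have hmem : (x, i, j) ∈ plaquettesIn Λ := by
      simp only [plaquettesIn, Finset.mem_filter, Finset.mem_product, Finset.mem_univ, and_self,
        and_true]
      exact ⟨hx, h, hxi, hxj, hxij⟩
    exact Finset.mem_image.2 ⟨⟨(x, i, j), hmem⟩, Finset.mem_attach _ _, rfl⟩
  simp only [Finset.mem_insert, Finset.mem_singleton] at hp
  rcases hp with rfl | rfl | rfl | rfl | rfl | rfl | rfl | rfl <;>
    refine key _ _ _ _ (hΛ (by decide +kernel)) (hΛ ?_) (hΛ ?_) (hΛ ?_) <;> decide +kernel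

/-- **The leading coefficient is the box integral, `κ = 2⁻⁸`.** -/
theorem kappa_SU2 :
    ∫ U, ∏ p ∈ ({(![0,0,0,0], ⟨(1, 2), lt12⟩), (![1,0,0,0], ⟨(0, 1), lt01⟩), (![2,0,0,0], ⟨(1, 2), lt12⟩),
        (![0,0,0,0], ⟨(0, 1), lt01⟩), (![0,0,1,0], ⟨(0, 1), lt01⟩), (![0,0,0,0], ⟨(0, 2), lt02⟩), (![0,1,0,0], ⟨(0,
        2), lt02⟩), (![1,0,1,0], ⟨(0, 1), lt01⟩), (![1,0,0,0], ⟨(0, 2), lt02⟩), (![1,1,0,0], ⟨(0, 2),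
        lt02⟩)} : Finset (ZdPlaquette 4)),
        (((fundamentalRep (Fin 2)) (U.plaquette p.1 p.2.1.1 p.2.1.2)).trace.re -
          ∫ g, ((fundamentalRep (Fin 2)) g).trace.re ∂haarProbability ↥(Matrix.specialUnitaryGroup (Fin 2) ℂ)) ∂zdHaar 4 ↥(Matrix.specialUnitaryGroup (Fin 2) ℂ) = 1 / 256 := by
  rw [integral_trace_re_eq_zero]
  simp only [sub_zero]
  exact boxIntegral_plaquetteObs

/-- **`⟨QP⟩_Λ - ⟨Q⟩_Λ⟨P⟩_Λ = 2⁻⁸ t⁸ + O(t⁹)`** for every finite region containing the box vertices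
(`SU(2)`, fundamental representation). -/
theorem truncated_SU2_isBigO (Λ : Finset (Site 4))
    (hΛ : ({![0,0,0,0], ![0,0,1,0], ![0,1,0,0], ![0,1,1,0], ![1,0,0,0], ![1,0,1,0], ![1,1,0,0], ![1,1,1,0],
        ![2,0,0,0], ![2,0,1,0], ![2,1,0,0], ![2,1,1,0]} : Finset (Site 4)) ⊆ Λ) :
    (fun t : ℝ => zdExpect (fundamentalRep (Fin 2)) t Λ (fun U => plaquetteObs (fundamentalRep (Fin 2)) ![0,0,0,0] 1 2 U *
          plaquetteObs (fundamentalRep (Fin 2)) ![1,0,0,0] 0 1 U) -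
        zdExpect (fundamentalRep (Fin 2)) t Λ (plaquetteObs (fundamentalRep (Fin 2)) ![0,0,0,0] 1 2) *
            zdExpect (fundamentalRep (Fin 2)) t Λ (plaquetteObs (fundamentalRep (Fin 2)) ![1,0,0,0] 0 1) -
        1 / 256 * t ^ 8) =O[𝓝 0] fun t : ℝ => t ^ 9 := by
  classical
  have hρ : Continuous (fundamentalRep (Fin 2)) := continuous_fundamentalRep (Fin 2)
  have hcard : (({(![2,0,0,0], ⟨(1, 2), lt12⟩), (![0,0,0,0], ⟨(0, 1), lt01⟩), (![0,0,1,0], ⟨(0, 1), lt01⟩),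
      (![0,0,0,0], ⟨(0, 2), lt02⟩), (![0,1,0,0], ⟨(0, 2), lt02⟩), (![1,0,1,0], ⟨(0, 1), lt01⟩), (![1,0,0,0], ⟨(0, 2),
      lt02⟩), (![1,1,0,0], ⟨(0, 2), lt02⟩)} : Finset (ZdPlaquette 4))).card = 8 := by decide +kernel
  have hq : ((![0,0,0,0], ⟨(1, 2), lt12⟩) : ZdPlaquette 4) ≠ (![1,0,0,0], ⟨(0, 1), lt01⟩) := by decide +kernel
  have hq1 : ((![0,0,0,0], ⟨(1, 2), lt12⟩) : ZdPlaquette 4) ∉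
      ({(![2,0,0,0], ⟨(1, 2), lt12⟩), (![0,0,0,0], ⟨(0, 1), lt01⟩), (![0,0,1,0], ⟨(0, 1), lt01⟩), (![0,0,0,0], ⟨(0,
          2), lt02⟩), (![0,1,0,0], ⟨(0, 2), lt02⟩), (![1,0,1,0], ⟨(0, 1), lt01⟩), (![1,0,0,0], ⟨(0, 2), lt02⟩),
          (![1,1,0,0], ⟨(0, 2), lt02⟩)} : Finset (ZdPlaquette 4)) := by decide +kernel
  have hq2 : ((![1,0,0,0], ⟨(0, 1), lt01⟩) : ZdPlaquette 4) ∉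
      ({(![2,0,0,0], ⟨(1, 2), lt12⟩), (![0,0,0,0], ⟨(0, 1), lt01⟩), (![0,0,1,0], ⟨(0, 1), lt01⟩), (![0,0,0,0], ⟨(0,
          2), lt02⟩), (![0,1,0,0], ⟨(0, 2), lt02⟩), (![1,0,1,0], ⟨(0, 1), lt01⟩), (![1,0,0,0], ⟨(0, 2), lt02⟩),
          (![1,1,0,0], ⟨(0, 2), lt02⟩)} : Finset (ZdPlaquette 4)) := by decide +kernel
  have H1 : ∀ Q ∈ (plaqSet Λ).powerset, Q.card ≤ (({(![2,0,0,0], ⟨(1, 2), lt12⟩), (![0,0,0,0], ⟨(0, 1), lt01⟩),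
      (![0,0,1,0], ⟨(0, 1), lt01⟩), (![0,0,0,0], ⟨(0, 2), lt02⟩), (![0,1,0,0], ⟨(0, 2), lt02⟩), (![1,0,1,0], ⟨(0, 1),
      lt01⟩), (![1,0,0,0], ⟨(0, 2), lt02⟩), (![1,1,0,0], ⟨(0, 2), lt02⟩)} : Finset (ZdPlaquette 4))).card →
      Q ≠ ({(![2,0,0,0], ⟨(1, 2), lt12⟩), (![0,0,0,0], ⟨(0, 1), lt01⟩), (![0,0,1,0], ⟨(0, 1), lt01⟩), (![0,0,0,0],
          ⟨(0, 2), lt02⟩), (![0,1,0,0], ⟨(0, 2), lt02⟩), (![1,0,1,0], ⟨(0, 1), lt01⟩), (![1,0,0,0], ⟨(0, 2), lt02⟩),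
          (![1,1,0,0], ⟨(0, 2), lt02⟩)} : Finset (ZdPlaquette 4)) →
      ∃ p ∈ insert ((![0,0,0,0], ⟨(1, 2), lt12⟩) : ZdPlaquette 4) (insert ((![1,0,0,0], ⟨(0, 1),
          lt01⟩) : ZdPlaquette 4) Q), ∃ ℓ ∈ plaquetteEdges p,
        ∀ p' ∈ insert ((![0,0,0,0], ⟨(1, 2), lt12⟩) : ZdPlaquette 4) (insert ((![1,0,0,0], ⟨(0, 1),
            lt01⟩) : ZdPlaquette 4) Q), p' ≠ p → ℓ ∉ plaquetteEdges p' :=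
    fun Q _ hQ hne => box_H1 Q (hQ.trans hcard.le) hne
  have h := StrongCouplingLeading.truncated_sub_leading_isBigO (d := 4) (G := ↥(Matrix.specialUnitaryGroup (Fin 2) ℂ))
    (ρ := fundamentalRep (Fin 2)) hρ Λ hq hq1 hq2 (box_subset_plaqSet Λ hΛ) H1
    (fun S hS hne hne' => box_sphere S hS hne hne')
  rw [hcard, kappa_SU2] at h
  exact h

/-- **The eighth Taylor coefficient of the one bit is `8!/256 ≠ 0`** for every finite region
containing the box vertices (`SU(2)`, fundamental representation): the hypothesis of the door
`S28OneBitFiniteVolume.gapCore_eventually_of_freeCoefficient_of_forall` with `k = 8`. -/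
theorem iteratedDeriv_eight_SU2 (Λ : Finset (Site 4))
    (hΛ : ({![0,0,0,0], ![0,0,1,0], ![0,1,0,0], ![0,1,1,0], ![1,0,0,0], ![1,0,1,0], ![1,1,0,0], ![1,1,1,0],
        ![2,0,0,0], ![2,0,1,0], ![2,1,0,0], ![2,1,1,0]} : Finset (Site 4)) ⊆ Λ) :
    iteratedDeriv 8 (fun t : ℝ =>
        (expect (fundamentalRep (Fin 2)) (fun U => ((plaquetteObs (fundamentalRep (Fin 2)) (0 : Site 4) 1 2 U *
              plaquetteObs (fundamentalRep (Fin 2)) (Pi.single 0 1 : Site 4) 0 1 U : ℝ) : ℂ)) Λ t).re -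
          (expect (fundamentalRep (Fin 2)) (fun U => (plaquetteObs (fundamentalRep (Fin 2)) (0 : Site 4) 1 2 U : ℂ)) Λ t).re *
            (expect (fundamentalRep (Fin 2))
              (fun U => (plaquetteObs (fundamentalRep (Fin 2)) (Pi.single 0 1 : Site 4) 0 1 U : ℂ)) Λ t).re)
        0 = Nat.factorial 8 / 256 := by
  classical
  haveI : SecondCountableTopology (Matrix (Fin 2) (Fin 2) ℂ) :=
    inferInstanceAs (SecondCountableTopology (Fin 2 → Fin 2 → ℂ))
  haveI : SecondCountableTopology ↥(Matrix.specialUnitaryGroup (Fin 2) ℂ) :=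
      TopologicalSpace.Subtype.secondCountableTopology _
  have hρ : Continuous (fundamentalRep (Fin 2)) := continuous_fundamentalRep (Fin 2)
  have hβ₁ : 0 < betaOne 4 (fundamentalRep (Fin 2)) := Literature.MathematicalPhysics.QuantumFieldTheory.betaOne_pos 4
  have h0 : |(0 : ℝ)| < betaOne 4 (fundamentalRep (Fin 2)) := by rw [abs_zero]; exact hβ₁
  have hmQ : Measurable (plaquetteObs (d := 4) (fundamentalRep (Fin 2)) (0 : Site 4) 1 2) :=
      measurable_plaquetteObs (fundamentalRep (Fin 2)) hρ (0 : Site 4) 1 2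
  have hmP : Measurable (plaquetteObs (d := 4) (fundamentalRep (Fin 2)) (Pi.single 0 1 : Site 4) 0 1) :=
    measurable_plaquetteObs (fundamentalRep (Fin 2)) hρ (Pi.single 0 1 : Site 4) 0 1
  have hbQ : ∀ U, |plaquetteObs (d := 4) (fundamentalRep (Fin 2)) (0 : Site 4) 1 2 U| ≤ (2 : ℕ) :=
    S28HalfSpaceTransfer.abs_plaquetteObs_le_card (fundamentalRep (Fin 2)) hρ (0 : Site 4) 1 2
  have hbP : ∀ U, |plaquetteObs (d := 4) (fundamentalRep (Fin 2)) (Pi.single 0 1 : Site 4) 0 1 U| ≤ (2 : ℕ) :=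
    S28HalfSpaceTransfer.abs_plaquetteObs_le_card (fundamentalRep (Fin 2)) hρ (Pi.single 0 1 : Site 4) 0 1
  have hbprod : ∀ U, |plaquetteObs (d := 4) (fundamentalRep (Fin 2)) (0 : Site 4) 1 2 U *
      plaquetteObs (d := 4) (fundamentalRep (Fin 2)) (Pi.single 0 1 : Site 4) 0 1 U| ≤ (2 : ℕ) * (2 : ℕ) :=
          fun U => by
    rw [abs_mul]
    exact mul_le_mul (hbQ U) (hbP U) (abs_nonneg _) ((abs_nonneg _).trans (hbQ U))
  -- analyticity of the two germs at `0`
  have ha : AnalyticAt ℝ (fun t : ℝ =>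
      (expect (fundamentalRep (Fin 2)) (fun U => ((plaquetteObs (fundamentalRep (Fin 2)) (0 : Site 4) 1 2 U *
          plaquetteObs (fundamentalRep (Fin 2)) (Pi.single 0 1 : Site 4) 0 1 U : ℝ) : ℂ)) Λ t).re -
        (expect (fundamentalRep (Fin 2)) (fun U => (plaquetteObs (fundamentalRep (Fin 2)) (0 : Site 4) 1 2 U : ℂ)) Λ t).re *
          (expect (fundamentalRep (Fin 2))
            (fun U => (plaquetteObs (fundamentalRep (Fin 2)) (Pi.single 0 1 : Site 4) 0 1 U : ℂ)) Λ t).re) 0 :=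
    (S28WitnessJets.analyticAt_re_expect (fundamentalRep (Fin 2)) hρ (F := fun U =>
        plaquetteObs (fundamentalRep (Fin 2)) (0 : Site 4) 1 2 U *
          plaquetteObs (fundamentalRep (Fin 2)) (Pi.single 0 1 : Site 4) 0 1 U) (hmQ.mul hmP) hbprod Λ h0).sub
      ((S28WitnessJets.analyticAt_re_expect (fundamentalRep (Fin 2)) hρ hmQ hbQ Λ h0).mul
        (S28WitnessJets.analyticAt_re_expect (fundamentalRep (Fin 2)) hρ hmP hbP Λ h0))
  have hg : AnalyticAt ℝ (fun t : ℝ => 1 / 256 * t ^ 8) 0 := analyticAt_const.mul (analyticAt_id.pow 8)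
  -- the truncated correlation in `zdExpect` form
  have e0 : (0 : Site 4) = ![0,0,0,0] := by decide
  have e1 : (Pi.single 0 1 : Site 4) = ![1,0,0,0] := by decide
  have hre : ∀ (F : LGConfig 4 ↥(Matrix.specialUnitaryGroup (Fin 2) ℂ) → ℝ), Measurable F → ∀ (C : ℝ), (∀ U,
      |F U| ≤ C) → ∀ t : ℝ,
      (expect (fundamentalRep (Fin 2)) (fun U => (F U : ℂ)) Λ t).re = zdExpect (fundamentalRep (Fin 2)) t Λ F :=
    fun F hm C hb t => (zdExpect_eq hρ t Λ hm hb).symm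
  have hfun : (fun t : ℝ =>
      (expect (fundamentalRep (Fin 2)) (fun U => ((plaquetteObs (fundamentalRep (Fin 2)) (0 : Site 4) 1 2 U *
          plaquetteObs (fundamentalRep (Fin 2)) (Pi.single 0 1 : Site 4) 0 1 U : ℝ) : ℂ)) Λ t).re -
        (expect (fundamentalRep (Fin 2)) (fun U => (plaquetteObs (fundamentalRep (Fin 2)) (0 : Site 4) 1 2 U : ℂ)) Λ t).re *
          (expect (fundamentalRep (Fin 2))
            (fun U => (plaquetteObs (fundamentalRep (Fin 2)) (Pi.single 0 1 : Site 4) 0 1 U : ℂ)) Λ t).re) =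
      fun t : ℝ => zdExpect (fundamentalRep (Fin 2)) t Λ (fun U => plaquetteObs (fundamentalRep (Fin 2)) ![0,0,0,0] 1 2 U *
          plaquetteObs (fundamentalRep (Fin 2)) ![1,0,0,0] 0 1 U) -
        zdExpect (fundamentalRep (Fin 2)) t Λ (plaquetteObs (fundamentalRep (Fin 2)) ![0,0,0,0] 1 2) *
            zdExpect (fundamentalRep (Fin 2)) t Λ (plaquetteObs (fundamentalRep (Fin 2)) ![1,0,0,0] 0 1) := by
    funext t
    rw [hre (fun U => plaquetteObs (fundamentalRep (Fin 2)) (0 : Site 4) 1 2 U *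
        plaquetteObs (fundamentalRep (Fin 2)) (Pi.single 0 1 : Site 4) 0 1 U) (hmQ.mul hmP) _ hbprod t,
      hre _ hmQ _ hbQ t, hre _ hmP _ hbP t]
    simp only [e0, e1]
  have hO : (fun t : ℝ => ((expect (fundamentalRep (Fin 2)) (fun U =>
          ((plaquetteObs (fundamentalRep (Fin 2)) (0 : Site 4) 1 2 U *
            plaquetteObs (fundamentalRep (Fin 2)) (Pi.single 0 1 : Site 4) 0 1 U : ℝ) : ℂ)) Λ t).re -
        (expect (fundamentalRep (Fin 2)) (fun U => (plaquetteObs (fundamentalRep (Fin 2)) (0 : Site 4) 1 2 U : ℂ)) Λ t).re *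
          (expect (fundamentalRep (Fin 2))
            (fun U => (plaquetteObs (fundamentalRep (Fin 2)) (Pi.single 0 1 : Site 4) 0 1 U : ℂ)) Λ t).re) -
        1 / 256 * t ^ 8) =O[𝓝 (0 : ℝ)] fun t : ℝ => t ^ 9 := by
    refine (truncated_SU2_isBigO Λ hΛ).congr_left fun t => ?_
    have := congrFun hfun t
    rw [this]
  rw [S28WitnessJets.iteratedDeriv_eq_of_isBigO_sub ha hg hO (by norm_num : 8 < 9)]
  rw [iteratedDeriv_const_mul _ (by fun_prop), iteratedDeriv_fun_pow_zero]
  simp only [if_true]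
  ring

/-- **THE ISLAND GAP CORE FOR `SU(2)` (the one bit of `S28ᵀ`, certified).** For the 4-d `SU(2)`
lattice gauge theory in the fundamental representation: for every sufficiently small `β > 0`, every
torus-limit state `μ` has strictly positive axial plaquette correlations `f_{β,μ}(n e₀) > 0` at all
distances and a positive inverse axial correlation length (`∃ m > 0, HasInvCorrLength f m`) — the
non-degeneracy that Osterwalder–Seiler clustering alone does not give, uniformly over torus-limit
states. Nothing is asserted for `β ≥ β₀`; the Yang–Mills mass gap is NOT proved. -/
theorem gapCore_eventually_SU2 :
    ∀ᶠ β in 𝓝[>] (0 : ℝ), ∀ μ ∈ infiniteVolumeLimitPoints (d := 4) (fundamentalRep (Fin 2)) β,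
      (∀ n : ℕ, 0 < plaquetteCorrFn (fundamentalRep (Fin 2)) μ ((n : ℤ) • Pi.single (0 : Fin 4) (1 : ℤ))) ∧
        ∃ m : ℝ, 0 < m ∧ HasInvCorrLength (plaquetteCorrFn (fundamentalRep (Fin 2)) μ) m := by
  haveI : SecondCountableTopology (Matrix (Fin 2) (Fin 2) ℂ) :=
    inferInstanceAs (SecondCountableTopology (Fin 2 → Fin 2 → ℂ))
  haveI : SecondCountableTopology ↥(Matrix.specialUnitaryGroup (Fin 2) ℂ) :=
      TopologicalSpace.Subtype.secondCountableTopology _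
  refine S28OneBitFiniteVolume.gapCore_eventually_of_freeCoefficient_of_forall (fundamentalRep (Fin 2))
    (continuous_fundamentalRep (Fin 2)) 8
    ({![0,0,0,0], ![0,0,1,0], ![0,1,0,0], ![0,1,1,0], ![1,0,0,0], ![1,0,1,0], ![1,1,0,0], ![1,1,1,0], ![2,0,0,0],
        ![2,0,1,0], ![2,1,0,0], ![2,1,1,0]} : Finset (Site 4)) fun Λ hΛ => ?_
  rw [iteratedDeriv_eight_SU2 Λ hΛ]
  positivity

end Summit.QuantumFields.YangMills.Theorems.S28OneBitSU2
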